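import Summits.QuantumFields.YangMills.Theorems.PoincareLipschitzSobolevCellTranslation
import Summits.QuantumFields.YangMills.Theorems.PoincareLipschitzSobolevCellTiling
import Summits.QuantumFields.YangMills.Theorems.PoincareLipschitzLatticeToContinuumCellLetters
import HarnessLib

/-!
# LINE 25 «compactness_transfer» (stmt-QuantumFields-23533), S2♭″ brick (Γ5-B) «THE SUMMED SHARP TRANSLATION ROW», FILE E —
# `Σ_{y ∈ box 0 n} ‖a_R(y+e_μ) − a_R y‖² ≤ R·‖GV·e_μ‖²_{L²(Q_{s′})}` for the cell averages of a Sobolev map, `(n+2)∕R ≤ s′`, constant exactly `1`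

Cell `ym3-torus` (YM ladder rung R3 — a RUNG, NOT the Clay problem: not d = 4, not infinite volume, not a mass gap); WIDTH COPY «width 15» of ym3-torus-p1,
gen 6; helper `--supports stmt-QuantumFields-23533`.  THEOREMS ONLY (0 `def`, default heartbeats).  Letters of FILES B–D (w7's open grid cell, `box 0 n`,
`unitVec`, `EuclideanSpace.single μ 1`, lit `diffQuot`, `MemSobolevDomain` ∕ `HasWeakFDerivOn`, `Q_{s′} = {∀ i, |x i| < s′}` via ✓`isOpen_absCube`).

WHY (w7 g13 12:54:19Z (Γ5) SIGNATURE-0 + pens: (Γ5-B) → px15; my 12:54:38Z MINE; w7's route adopted verbatim).  The recovery sequence's main term needs the lattice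
Dirichlet energy of the cell averages bounded by the continuum energy with constant EXACTLY `1` (no doubling from overlapping two-cell boxes): per cell,
`‖Δ_μ a(y)‖ₑ² ≤ R·∫⁻_{cell_y}‖D^{1∕R}_{e_μ}V‖ₑ²` (§2, Jensen on the cell of volume `R⁻³`), the OPEN CELLS ARE PAIRWISE DISJOINT (w7 ✓`disjoint_cell`) so the sum over
`y ∈ box 0 n` is `R·∫⁻_{⋃ cells} ≤ R·∫⁻_{B_n}` with the big open box `B_n = Π(−n∕R,(n+1)∕R)`, and ONE application of lit ✓`SobolevDifferenceQuotients.eLpNorm_diffQuot_le`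
(Evans §5.8.2 Thm 3 (i), PROVED via Meyers–Serrin) at `Ω′ := B_n`, `Ω := Q_{s′}`, `t := R⁻¹`, `v := e_μ` — its segments `x + s·R⁻¹e_μ` stay in `Q_{s′}` iff `(n+2)∕R ≤ s′`.
CONTENTS: §1 `isOpen_bigBox` · `cell_subset_bigBox` · `twoCell_subset_absCube` · `bigBox_subset_absCube` · `segment_bigBox_mem_absCube` (the finite volume of `Q_t` is px3 g8's ✓`…LatticeToContinuumCellLetters.volume_absCube_lt_top`, imported); §2
★`enorm_sub_smul_setIntegral_sq_le_lintegral` (abstract `cell, cell′ ⊆ Ω`, `V` integrable on `Ω`: `‖κ•(∫_{cell′}V) − κ•(∫_{cell}V)‖ₑ² ≤ ofReal(κ²t²·vol cell)·∫⁻_{cell}‖D^t_vV‖ₑ²`);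
§3 ★★★`sum_enorm_sub_cellAverage_sq_le (hR : 0 < R) (n) (hs : ((n:ℝ)+2)∕R ≤ s′) (μ) (V GV) (hV : MemSobolevDomain 1 2 ⟨Q_{s′}⟩ volume V) (hGV : HasWeakFDerivOn ⟨Q_{s′}⟩ volume V GV)
(a) (ha : ∀ y, a y = R³•∫_{cell_y} V) : Σ_{y ∈ box 0 n} ‖a (y + unitVec μ) − a y‖ₑ² ≤ ofReal R * eLpNorm (fun x => GV x (single μ 1)) 2 (vol|Q_{s′}) ^ 2`.
The consumer feeds `hV`∕`hGV` on `Q_{s′}` from the cube `Q` by FILE B ★`memSobolevDomain_one_two_of_bound` ∕ `hasWeakFDerivOn_mono` (`Q_{s′} ≤ Q` for `s′ ≤ 1`).  HONEST SCOPE: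
NOTHING here proves Γ5, S2♭″, the organ, `BlockLipschitzL`, `HistoryTailL`, or any summit statement; YM₃ on T³ is rung R3, not Clay. [cite: Evans2010, §5.8.2 Theorem 3 (i)]
-/

noncomputable section

open MeasureTheory Set Function Filter TopologicalSpace Metric Module
open scoped NNReal ENNReal Topology

namespace Summit.QuantumFields.YangMills.Theorems.PoincareLipschitzSobolevCellTranslationSum

open Literature.Analysis.FunctionSpaces
open Literature.MathematicalPhysics.QuantumFieldTheory.Balaban1983to89
open B4Eq19LatticeOperators (Zd box mem_box unitVec)
open Summit.QuantumFields.YangMills.Theorems.PoincareLipschitzSobolevCellAverages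
open Summit.QuantumFields.YangMills.Theorems.PoincareLipschitzSobolevCellTranslation
open Summit.QuantumFields.YangMills.Theorems.PoincareLipschitzSobolevCellTiling (eLpNorm_two_pow_two)
open Summit.QuantumFields.YangMills.Theorems.PoincareLipschitzSamplingCells
  (disjoint_cell isOpen_absCube measurableSet_cell)
open Summit.QuantumFields.YangMills.Theorems.PoincareLipschitzLatticeToContinuumCellLetters (volume_absCube_lt_top)

/-! ## §1 The big open box `B_n = Π (−n∕R, (n+1)∕R)` and the cube `Q_{s′}` -/

/-- The big open box `Π (−n∕R, (n+1)∕R)` is open. [folklore] -/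
theorem isOpen_bigBox (R n : ℕ) :
    IsOpen {x : EuclideanSpace ℝ (Fin 3) | ∀ i, -(n : ℝ) / R < x i ∧ x i < ((n : ℝ) + 1) / R} := by
  have h : {x : EuclideanSpace ℝ (Fin 3) | ∀ i, -(n : ℝ) / R < x i ∧ x i < ((n : ℝ) + 1) / R} =
      ⋂ i : Fin 3, {x | -(n : ℝ) / R < x i ∧ x i < ((n : ℝ) + 1) / R} := by
    ext x; simp
  rw [h]
  exact isOpen_iInter_of_finite fun i =>
    (isOpen_lt continuous_const (EuclideanSpace.proj i).continuous).inter
      (isOpen_lt (EuclideanSpace.proj i).continuous continuous_const)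

/-- Cells with labels in `box 0 n` lie in the big box. [folklore] -/
theorem cell_subset_bigBox {R : ℕ} (hR : 0 < R) {n : ℕ} {y : Zd 3} (hy : y ∈ box (0 : Zd 3) (n : ℤ)) :
    {x : EuclideanSpace ℝ (Fin 3) | ∀ i, (y i : ℝ) / R < x i ∧ x i < ((y i : ℝ) + 1) / R} ⊆
      {x : EuclideanSpace ℝ (Fin 3) | ∀ i, -(n : ℝ) / R < x i ∧ x i < ((n : ℝ) + 1) / R} := by
  have hR0 : (0 : ℝ) < R := by exact_mod_cast hR
  intro x hx i
  have hyi : |(y i : ℝ)| ≤ n := by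
    have h1 : |y i - (0 : Zd 3) i| ≤ (n : ℤ) := (mem_box.mp hy) i
    simp only [Pi.zero_apply, sub_zero] at h1
    exact_mod_cast h1
  rw [abs_le] at hyi
  obtain ⟨hlo, hhi⟩ := hx i
  constructor
  · have : -(n : ℝ) / R ≤ (y i : ℝ) / R := by gcongr; linarith [hyi.1]
    linarith
  · have : ((y i : ℝ) + 1) / R ≤ ((n : ℝ) + 1) / R := by gcongr; linarith [hyi.2]
    linarith

/-- The two-cell box of a label in `box 0 n` lies in `Q_{s′}` when `(n+2)∕R ≤ s′`. [folklore] -/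
theorem twoCell_subset_absCube {R : ℕ} (hR : 0 < R) {n : ℕ} {s' : ℝ} (hs : ((n : ℝ) + 2) / R ≤ s')
    {y : Zd 3} (hy : y ∈ box (0 : Zd 3) (n : ℤ)) (μ : Fin 3) :
    {x : EuclideanSpace ℝ (Fin 3) | ∀ i, (y i : ℝ) / R < x i ∧
        x i < ((y i : ℝ) + (if i = μ then 2 else 1)) / R} ⊆
      {x : EuclideanSpace ℝ (Fin 3) | ∀ i : Fin 3, |x i| < s'} := by
  have hR0 : (0 : ℝ) < R := by exact_mod_cast hR
  intro x hx i
  have hyi : |(y i : ℝ)| ≤ n := by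
    have h1 : |y i - (0 : Zd 3) i| ≤ (n : ℤ) := (mem_box.mp hy) i
    simp only [Pi.zero_apply, sub_zero] at h1
    exact_mod_cast h1
  rw [abs_le] at hyi
  obtain ⟨hlo, hhi⟩ := hx i
  have hup : ((y i : ℝ) + (if i = μ then 2 else 1)) / R ≤ ((n : ℝ) + 2) / R := by
    gcongr
    · linarith [hyi.2]
    · split_ifs <;> norm_num
  have hdn : -s' < (y i : ℝ) / R := by
    have h3 : -(n : ℝ) / R ≤ (y i : ℝ) / R := by gcongr; linarith [hyi.1]
    have h4 : (n : ℝ) / R < ((n : ℝ) + 2) / R := by gcongr; linarith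
    rw [neg_div] at h3; linarith
  rw [abs_lt]; constructor <;> linarith

/-- The big box lies in the cube `Q_{s′}` when `(n+2)∕R ≤ s′`. [folklore] -/
theorem bigBox_subset_absCube {R : ℕ} (hR : 0 < R) {n : ℕ} {s' : ℝ} (hs : ((n : ℝ) + 2) / R ≤ s') :
    {x : EuclideanSpace ℝ (Fin 3) | ∀ i, -(n : ℝ) / R < x i ∧ x i < ((n : ℝ) + 1) / R} ⊆
      {x : EuclideanSpace ℝ (Fin 3) | ∀ i : Fin 3, |x i| < s'} := by
  have hR0 : (0 : ℝ) < R := by exact_mod_cast hR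
  intro x hx i
  obtain ⟨hlo, hhi⟩ := hx i
  have h1 : ((n : ℝ) + 1) / R < s' := by
    have : ((n : ℝ) + 1) / R < ((n : ℝ) + 2) / R := by gcongr; linarith
    linarith
  have h2 : -s' < -(n : ℝ) / R := by
    have : (n : ℝ) / R < ((n : ℝ) + 2) / R := (div_lt_div_iff_of_pos_right hR0).2 (by linarith)
    rw [neg_div]; linarith
  rw [abs_lt]; constructor <;> linarith

/-- Segments `x + s·R⁻¹e_μ` (`s ∈ [0,1]`) from the big box stay in `Q_{s′}` when `(n+2)∕R ≤ s′`.
[folklore] -/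
theorem segment_bigBox_mem_absCube {R : ℕ} (hR : 0 < R) {n : ℕ} {s' : ℝ}
    (hs : ((n : ℝ) + 2) / R ≤ s') (μ : Fin 3) {x : EuclideanSpace ℝ (Fin 3)}
    (hx : x ∈ {x : EuclideanSpace ℝ (Fin 3) | ∀ i, -(n : ℝ) / R < x i ∧ x i < ((n : ℝ) + 1) / R})
    {s : ℝ} (hs01 : s ∈ Icc (0 : ℝ) 1) :
    x + (s * (R : ℝ)⁻¹) • EuclideanSpace.single μ (1 : ℝ) ∈
      {x : EuclideanSpace ℝ (Fin 3) | ∀ i : Fin 3, |x i| < s'} := by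
  have hR0 : (0 : ℝ) < R := by exact_mod_cast hR
  intro i
  obtain ⟨hlo, hhi⟩ := hx i
  have hn2 : ((n : ℝ) + 2) / R = ((n : ℝ) + 1) / R + (R : ℝ)⁻¹ := by ring
  have h2 : -s' < -(n : ℝ) / R := by
    have : (n : ℝ) / R < ((n : ℝ) + 2) / R := (div_lt_div_iff_of_pos_right hR0).2 (by linarith)
    rw [neg_div]; linarith
  by_cases hi : i = μ
  · subst hi
    have h1 : (x + (s * (R : ℝ)⁻¹) • EuclideanSpace.single i (1 : ℝ)) i = x i + s * (R : ℝ)⁻¹ := by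
      simp
    rw [h1, abs_lt]
    constructor
    · nlinarith [hs01.1, inv_pos.2 hR0]
    · have : s * (R : ℝ)⁻¹ ≤ (R : ℝ)⁻¹ := by nlinarith [hs01.2, inv_pos.2 hR0]
      linarith
  · have h1 : (x + (s * (R : ℝ)⁻¹) • EuclideanSpace.single μ (1 : ℝ)) i = x i := by simp [hi]
    rw [h1, abs_lt]
    have : ((n : ℝ) + 1) / R < s' := by
      have : ((n : ℝ) + 1) / R < ((n : ℝ) + 2) / R := by gcongr; linarith
      linarith
    constructor <;> linarith

/-! ## §2 One cell: the translation difference against the difference quotient on the cell -/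

/-- On one cell: `‖κ•∫_{cell′}V − κ•∫_{cell}V‖ₑ² ≤ ofReal(κ²t²c)·∫⁻_{cell}‖D^t_vV‖ₑ²` for `V` integrable
on a set `Ω ⊇ cell, cell′`, `cell′ = cell + t v`, `volume cell = ofReal c`. [folklore] -/
theorem enorm_sub_smul_setIntegral_sq_le_lintegral {Ω cell cell' : Set (EuclideanSpace ℝ (Fin 3))}
    (hsub : cell ⊆ Ω) (hsub' : cell' ⊆ Ω) {c : ℝ} (hvol : volume cell = ENNReal.ofReal c)
    {t : ℝ} (ht : t ≠ 0) (v : EuclideanSpace ℝ (Fin 3))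
    (hpre : (fun x : EuclideanSpace ℝ (Fin 3) => x + t • v) ⁻¹' cell' = cell)
    (V : EuclideanSpace ℝ (Fin 3) → EuclideanSpace ℝ (Fin 4)) (hVint : IntegrableOn V Ω volume) (κ : ℝ) :
    ‖κ • (∫ x in cell', V x) - κ • (∫ x in cell, V x)‖ₑ ^ 2 ≤
      ENNReal.ofReal (κ ^ 2 * t ^ 2 * c) * ∫⁻ x in cell, ‖diffQuot v t V x‖ₑ ^ 2 := by
  have hI1 : IntegrableOn V cell volume := hVint.mono_set hsub
  have hmp : MeasurePreserving (fun x : EuclideanSpace ℝ (Fin 3) => x + t • v) volume volume :=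
    measurePreserving_add_right volume _
  have hme : MeasurableEmbedding (fun x : EuclideanSpace ℝ (Fin 3) => x + t • v) :=
    (Homeomorph.addRight (t • v)).measurableEmbedding
  have hI2 : IntegrableOn (fun x => V (x + t • v)) cell volume := by
    have h3 : IntegrableOn V cell' volume := hVint.mono_set hsub'
    have h4 := (hmp.integrableOn_comp_preimage hme).2 h3
    rw [hpre] at h4
    exact h4
  have htrans : ∫ x in cell', V x = ∫ x in cell, V (x + t • v) := by
    have h := hmp.setIntegral_preimage_emb hme V cell'
    rw [hpre] at h
    exact h.symm
  have hq : ∀ x, V (x + t • v) - V x = t • diffQuot v t V x := fun x => by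
    rw [diffQuot_apply, smul_smul, mul_inv_cancel₀ ht, one_smul]
  have hdiff : κ • (∫ x in cell', V x) - κ • (∫ x in cell, V x) =
      (κ * t) • ∫ x in cell, diffQuot v t V x := by
    calc κ • (∫ x in cell', V x) - κ • (∫ x in cell, V x)
        = κ • (∫ x in cell, V (x + t • v)) - κ • (∫ x in cell, V x) := by rw [htrans]
      _ = κ • ∫ x in cell, (V (x + t • v) - V x) := by rw [integral_sub hI2 hI1, smul_sub]
      _ = κ • ∫ x in cell, t • diffQuot v t V x := by simp_rw [hq]
      _ = (κ * t) • ∫ x in cell, diffQuot v t V x := by rw [integral_smul, smul_smul]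
  have hmeas : AEStronglyMeasurable (diffQuot v t V) (volume.restrict cell) := by
    have : diffQuot v t V = t⁻¹ • ((fun x => V (x + t • v)) - V) := by
      funext x; simp [diffQuot_apply]
    rw [this]
    exact (hI2.sub hI1).aestronglyMeasurable.const_smul _
  have hCS := enorm_setIntegral_sq_le (ν := volume) (diffQuot v t V) hmeas
  rw [hvol, eLpNorm_two_pow_two] at hCS
  rw [hdiff, enorm_smul, mul_pow, Real.enorm_eq_ofReal_abs, ← ENNReal.ofReal_pow (abs_nonneg _),
    sq_abs]
  calc ENNReal.ofReal ((κ * t) ^ 2) * ‖∫ x in cell, diffQuot v t V x‖ₑ ^ 2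
      ≤ ENNReal.ofReal ((κ * t) ^ 2) * (ENNReal.ofReal c * ∫⁻ x in cell, ‖diffQuot v t V x‖ₑ ^ 2) := by
        gcongr
    _ = ENNReal.ofReal (κ ^ 2 * t ^ 2 * c) * ∫⁻ x in cell, ‖diffQuot v t V x‖ₑ ^ 2 := by
        rw [← mul_assoc, ← ENNReal.ofReal_mul (by positivity)]
        ring_nf

/-! ## §3 (Γ5-B) The summed sharp row -/

/-- ★★★ **(Γ5-B) THE SUMMED SHARP TRANSLATION ROW** (constant exactly `1`): for `V ∈ W^{1,2}(Q_{s′}; ℝ⁴)`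
with weak derivative `GV` on the open cube `Q_{s′} = {|xᵢ| < s′}`, cell averages
`a y = R³•∫_{cell_y} V`, a direction `μ`, and `n` with `(n+2)∕R ≤ s′`:
`Σ_{y ∈ box 0 n} ‖a(y+e_μ) − a y‖ₑ² ≤ R · ‖GV·e_μ‖²_{L²(Q_{s′})}`
— per cell `‖Δ_μ a(y)‖ₑ² ≤ R·∫⁻_{cell_y}‖D^{1∕R}_{e_μ}V‖ₑ²` (§2, Jensen), the open cells are pairwise
disjoint (w7 ✓`disjoint_cell`) so the sum is `R·∫⁻_{⋃ cells} ≤ R·∫⁻_{B_n}`, `B_n = Π(−n∕R,(n+1)∕R)`,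
and ONE application of lit ✓`eLpNorm_diffQuot_le` (`Ω′ := B_n`, `Ω := Q_{s′}`, `t := R⁻¹`,
`v := e_μ`; segments stay in `Q_{s′}`). [cite: Evans2010, §5.8.2 Theorem 3 (i)] -/
theorem sum_enorm_sub_cellAverage_sq_le {R : ℕ} (hR : 0 < R) (n : ℕ) {s' : ℝ}
    (hs : ((n : ℝ) + 2) / R ≤ s') (μ : Fin 3)
    (V : EuclideanSpace ℝ (Fin 3) → EuclideanSpace ℝ (Fin 4))
    (GV : EuclideanSpace ℝ (Fin 3) → EuclideanSpace ℝ (Fin 3) →L[ℝ] EuclideanSpace ℝ (Fin 4))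
    (hV : MemSobolevDomain 1 2 (⟨{x : EuclideanSpace ℝ (Fin 3) | ∀ i : Fin 3, |x i| < s'},
      isOpen_absCube s'⟩ : Opens _) volume V)
    (hGV : HasWeakFDerivOn (⟨{x : EuclideanSpace ℝ (Fin 3) | ∀ i : Fin 3, |x i| < s'},
      isOpen_absCube s'⟩ : Opens _) volume V GV)
    (a : Zd 3 → EuclideanSpace ℝ (Fin 4))
    (ha : ∀ y, a y = ((R : ℝ) ^ 3) • ∫ x in {x : EuclideanSpace ℝ (Fin 3) |
        ∀ i, (y i : ℝ) / R < x i ∧ x i < ((y i : ℝ) + 1) / R}, V x) :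
    ∑ y ∈ box (0 : Zd 3) (n : ℤ), ‖a (y + unitVec μ) - a y‖ₑ ^ 2 ≤
      ENNReal.ofReal (R : ℝ) * eLpNorm (fun x => GV x (EuclideanSpace.single μ (1 : ℝ))) 2
        (volume.restrict {x : EuclideanSpace ℝ (Fin 3) | ∀ i : Fin 3, |x i| < s'}) ^ 2 := by
  have hR0 : (0 : ℝ) < R := by exact_mod_cast hR
  set Q : Set (EuclideanSpace ℝ (Fin 3)) := {x | ∀ i : Fin 3, |x i| < s'} with hQ
  set B : Set (EuclideanSpace ℝ (Fin 3)) := {x | ∀ i, -(n : ℝ) / R < x i ∧ x i < ((n : ℝ) + 1) / R}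
    with hB
  set oc : Zd 3 → Set (EuclideanSpace ℝ (Fin 3)) := fun y =>
    {x | ∀ i, (y i : ℝ) / R < x i ∧ x i < ((y i : ℝ) + 1) / R} with hoc
  set v : EuclideanSpace ℝ (Fin 3) := EuclideanSpace.single μ (1 : ℝ) with hv
  set t : ℝ := (R : ℝ)⁻¹ with ht
  have ht0 : t ≠ 0 := inv_ne_zero hR0.ne'
  have hBQ : B ⊆ Q := bigBox_subset_absCube hR hs
  haveI : IsFiniteMeasure (volume.restrict Q) := isFiniteMeasure_restrict.2 (volume_absCube_lt_top s').ne
  have hVint : IntegrableOn V Q volume := hV.memLp.integrable (by norm_num)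
  -- (1) per cell: Jensen against the difference quotient
  have h1 : ∀ y ∈ box (0 : Zd 3) (n : ℤ), ‖a (y + unitVec μ) - a y‖ₑ ^ 2 ≤
      ENNReal.ofReal (R : ℝ) * ∫⁻ x in oc y, ‖diffQuot v t V x‖ₑ ^ 2 := by
    intro y hy
    have hcell : oc y ⊆ Q := (cell_subset_bigBox hR hy).trans hBQ
    have hcell' : {x : EuclideanSpace ℝ (Fin 3) | ∀ i, ((y + unitVec μ) i : ℝ) / R < x i ∧
        x i < (((y + unitVec μ) i : ℝ) + 1) / R} ⊆ Q :=
      (cell_succ_subset_twoCell hR y μ).trans (twoCell_subset_absCube hR hs hy μ)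
    have h := enorm_sub_smul_setIntegral_sq_le_lintegral hcell hcell' (c := ((R : ℝ)⁻¹) ^ 3)
      (volume_cell hR y) ht0 v (preimage_translate_cell hR y μ) V hVint ((R : ℝ) ^ 3)
    rw [ha (y + unitVec μ), ha y]
    have e : ((R : ℝ) ^ 3) ^ 2 * t ^ 2 * ((R : ℝ)⁻¹) ^ 3 = R := by rw [ht]; field_simp
    rw [e] at h
    exact h
  -- (2) the disjoint cells sit inside the big box
  have h2 : ∑ y ∈ box (0 : Zd 3) (n : ℤ), ∫⁻ x in oc y, ‖diffQuot v t V x‖ₑ ^ 2 ≤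
      ∫⁻ x in B, ‖diffQuot v t V x‖ₑ ^ 2 := by
    rw [← lintegral_biUnion_finset (fun y _ y' _ hne => disjoint_cell hR hne)
      (fun y _ => measurableSet_cell R y)]
    exact lintegral_mono_set (Set.iUnion₂_subset fun y hy => cell_subset_bigBox hR hy)
  -- (3) Evans §5.8.2 Thm 3 (i) once, on the big box inside `Q_{s′}`
  have h3 : ∫⁻ x in B, ‖diffQuot v t V x‖ₑ ^ 2 ≤
      eLpNorm (fun x => GV x v) 2 (volume.restrict Q) ^ 2 := by
    rw [← eLpNorm_two_pow_two]
    have hdq : eLpNorm (diffQuot v t V) 2 (volume.restrict B) ≤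
        eLpNorm (fun x => GV x v) 2 (volume.restrict Q) :=
      eLpNorm_diffQuot_le volume (Ω := ⟨Q, isOpen_absCube s'⟩) (Ω' := ⟨B, isOpen_bigBox R n⟩)
        (p := 2) (by norm_num) ENNReal.ofNat_ne_top hV hGV
        (fun x hx s hs01 => segment_bigBox_mem_absCube hR hs μ hx hs01)
    gcongr
  calc ∑ y ∈ box (0 : Zd 3) (n : ℤ), ‖a (y + unitVec μ) - a y‖ₑ ^ 2
      ≤ ∑ y ∈ box (0 : Zd 3) (n : ℤ), ENNReal.ofReal (R : ℝ) * ∫⁻ x in oc y, ‖diffQuot v t V x‖ₑ ^ 2 :=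
        Finset.sum_le_sum h1
    _ = ENNReal.ofReal (R : ℝ) * ∑ y ∈ box (0 : Zd 3) (n : ℤ), ∫⁻ x in oc y, ‖diffQuot v t V x‖ₑ ^ 2 := by
        rw [Finset.mul_sum]
    _ ≤ ENNReal.ofReal (R : ℝ) * ∫⁻ x in B, ‖diffQuot v t V x‖ₑ ^ 2 := by gcongr
    _ ≤ ENNReal.ofReal (R : ℝ) * eLpNorm (fun x => GV x v) 2 (volume.restrict Q) ^ 2 := by gcongr

end Summit.QuantumFields.YangMills.Theorems.PoincareLipschitzSobolevCellTranslationSum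

end
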